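import Mathlib.RingTheory.Valuation.Basic
import Mathlib.LinearAlgebra.Matrix.NonsingularInverse
import Mathlib.LinearAlgebra.Matrix.Notation
import HarnessLib

/-!
# «ORIENT★» — orientation read-off for the hyperbolic shells `b·S_n` and `w(b·S_n)w⁻¹` (ROAD-D, (D-c)(β))

Count-neutral helper kit for the stable-character transfer statement of the `H413` crux chain
(`--supports stmt-HodgeConjecture-24833`): THEOREMS ONLY, pure valuation algebra in a valued field, generic in
`(v : Valuation K Γ₀)` (the consumer instantiates `v := Valued.v` on `L_w`, `σ := σ_w` with `v (σ_w x) = v x`).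

The contracting element of the CM Iwahori datum is `e(𝓘.a) = diag(α, 1, (σα)⁻¹)` with `v α < 1` (★ `exists_cmIwahoriDatum`);
a point of the ray `b·S_n` (`b = z·k`, `k` in the level box, `z` central) has diagonal entries
`(e₀, e₁, e₂) = (z·α^m·s₀, z·s₁, z·(σα)⁻¹^m·s₂)` with units `s_i` and `m ≥ 1`.

* §0 `diagonal_three_pow`: `diag(α, 1, (σα)⁻¹)^m = diag(α^m, 1, (σα)⁻¹^m)`.
* §1 **(O1)** the strict chain `v e₀ < v e₁ < v e₂` (`v_ray_fst_lt_mid`, `v_ray_mid_lt_last`, `v_ray_fst_lt_last`): read with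
  `(d″0, u, d″1) = (e₀, e₁, e₂)` the ray `b·S_n` has `v(d″0) < v(u) < v(d″1)` — it is ANTI-oriented for the Levi frame՚s
  `v(d″1) < v(d″0)` (`not_v_ray_last_lt_fst`).
* §2 **(O2)** the Weyl flip `(d″0, u, d″1) := (e₂, e₁, e₀)` IS oriented, in the exact shape of the two side conditions of
  ★ `F0P3cStCharTSDeltaCosetConst` ∕ ★ `F0P3cStCharTSOnStratumLeviFrame` (`v(u) < v(d″0)`, `v(d″1) < v(u)`, hence
  `v(d″1) < v(d″0)`), and the swapped pair keeps the torus relation `σ(d″0)·d″1 = 1` (`sigma_mul_eq_one_flip`).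
* §3 **(O3)** the two shells are disjoint at the level of diagonal entries (`ne_of_v_lt_of_v_gt`, `v_lt_asymm_pair`).

## References
* [Rogawski1990] J. D. Rogawski, *Automorphic Representations of Unitary Groups in Three Variables* (1990), §4.9 p. 56
  (hyperbolic classes `|d₀|_w > |u|_w > |d₁|_w` of `U(2) × U(1)`), L. 12.7.2 p. 193 (the shells).
* [Casselman1995] W. Casselman, *Introduction to the theory of admissible representations of p-adic reductive groups* (1995),
  §1.4 (the contracting element `a` of an Iwahori factorisation, `|α(a)| < 1`).
-/

set_option autoImplicit false
-- the mandated namespace has the single-problem summit's repeated segment (`HodgeConjecture.HodgeConjecture`)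
set_option linter.dupNamespace false

namespace Summit.HodgeConjecture.HodgeConjecture.Cruxes.H413.F0P3cStCharTSShellOrientation

/-! ## §0 Powers of the contracting element -/

/-- `diag(α, 1, β)^m = diag(α^m, 1, β^m)` (Mathlib `Matrix.diagonal_pow`); at `β = (σα)⁻¹` this is `e(𝓘.a^m)`.
[cite: Casselman1995, §1.4] -/
theorem diagonal_three_pow {R : Type*} [CommRing R] (α β : R) (m : ℕ) :
    (Matrix.diagonal ![α, 1, β]) ^ m = Matrix.diagonal ![α ^ m, 1, β ^ m] := by
  rw [Matrix.diagonal_pow]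
  congr 1
  funext i
  fin_cases i <;> simp

variable {K : Type*} [Field K] {Γ₀ : Type*} [LinearOrderedCommGroupWithZero Γ₀] (v : Valuation K Γ₀)

/-! ## §1 (O1) The ray `b·S_n` is anti-oriented -/

/-- `v (α^m) < 1` for `v α < 1`, `m ≥ 1`. [cite: Casselman1995, §1.4] -/
theorem v_pow_lt_one {α : K} (hα : v α < 1) {m : ℕ} (hm : 1 ≤ m) : v (α ^ m) < 1 := by
  rw [map_pow]
  exact pow_lt_one₀ zero_le hα (Nat.one_le_iff_ne_zero.1 hm)

/-- `1 < v ((σα)⁻¹^m)` for `v (σ α) = v α < 1`, `α ≠ 0`, `m ≥ 1`. [cite: Casselman1995, §1.4] -/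
theorem one_lt_v_inv_pow (σ : K → K) {α : K} (hσ : v (σ α) = v α) (hα0 : α ≠ 0) (hα : v α < 1) {m : ℕ}
    (hm : 1 ≤ m) : 1 < v ((σ α)⁻¹ ^ m) := by
  have hvα0 : v α ≠ 0 := (Valuation.ne_zero_iff v).2 hα0
  rw [map_pow, map_inv₀, hσ]
  exact one_lt_pow₀ ((one_lt_inv₀ (zero_lt_iff.2 hvα0)).2 hα) (Nat.one_le_iff_ne_zero.1 hm)

/-- **(O1a)** first ray entry below the middle one: `v (z·α^m·s₀) < v (z·s₁)`. [cite: Rogawski1990, §4.9 p. 56] -/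
theorem v_ray_fst_lt_mid {z α s₀ s₁ : K} (hz : v z ≠ 0) (hα : v α < 1) {m : ℕ} (hm : 1 ≤ m)
    (hs₀ : v s₀ = 1) (hs₁ : v s₁ = 1) : v (z * α ^ m * s₀) < v (z * s₁) := by
  rw [map_mul, map_mul, map_mul, hs₀, hs₁, mul_one, mul_one]
  calc v z * v (α ^ m) < v z * 1 := mul_lt_mul_of_pos_left (v_pow_lt_one v hα hm) (zero_lt_iff.2 hz)
    _ = v z := mul_one _

/-- **(O1b)** middle ray entry below the last one: `v (z·s₁) < v (z·(σα)⁻¹^m·s₂)`. [cite: Rogawski1990, §4.9 p. 56] -/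
theorem v_ray_mid_lt_last (σ : K → K) {z α s₁ s₂ : K} (hz : v z ≠ 0) (hσ : v (σ α) = v α) (hα0 : α ≠ 0)
    (hα : v α < 1) {m : ℕ} (hm : 1 ≤ m) (hs₁ : v s₁ = 1) (hs₂ : v s₂ = 1) :
    v (z * s₁) < v (z * (σ α)⁻¹ ^ m * s₂) := by
  rw [map_mul, map_mul, map_mul, hs₁, hs₂, mul_one, mul_one]
  calc v z = v z * 1 := (mul_one _).symm
    _ < v z * v ((σ α)⁻¹ ^ m) := mul_lt_mul_of_pos_left (one_lt_v_inv_pow v σ hσ hα0 hα hm) (zero_lt_iff.2 hz)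

/-- **(O1c)** the strict chain end to end: `v (z·α^m·s₀) < v (z·(σα)⁻¹^m·s₂)`. [cite: Rogawski1990, §4.9 p. 56] -/
theorem v_ray_fst_lt_last (σ : K → K) {z α s₀ s₁ s₂ : K} (hz : v z ≠ 0) (hσ : v (σ α) = v α) (hα0 : α ≠ 0)
    (hα : v α < 1) {m : ℕ} (hm : 1 ≤ m) (hs₀ : v s₀ = 1) (hs₁ : v s₁ = 1) (hs₂ : v s₂ = 1) :
    v (z * α ^ m * s₀) < v (z * (σ α)⁻¹ ^ m * s₂) :=
  (v_ray_fst_lt_mid v hz hα hm hs₀ hs₁).trans (v_ray_mid_lt_last v σ hz hσ hα0 hα hm hs₁ hs₂)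

/-- **(O1) ANTI-ORIENTATION of `b·S_n`**: read with `(d″0, u, d″1) = (e₀, e₁, e₂)`, the Levi frame՚s side condition
`v(d″1) < v(d″0)` FAILS on the ray. [cite: Rogawski1990, §4.9 p. 56] -/
theorem not_v_ray_last_lt_fst (σ : K → K) {z α s₀ s₁ s₂ : K} (hz : v z ≠ 0) (hσ : v (σ α) = v α) (hα0 : α ≠ 0)
    (hα : v α < 1) {m : ℕ} (hm : 1 ≤ m) (hs₀ : v s₀ = 1) (hs₁ : v s₁ = 1) (hs₂ : v s₂ = 1) :
    ¬ v (z * (σ α)⁻¹ ^ m * s₂) < v (z * α ^ m * s₀) :=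
  lt_asymm (v_ray_fst_lt_last v σ hz hσ hα0 hα hm hs₀ hs₁ hs₂)

/-- **(O1′) nor the weaker middle condition**: `v(u) < v(d″0)` fails on the ray as well. [cite: Rogawski1990, §4.9 p. 56] -/
theorem not_v_ray_mid_lt_fst {z α s₀ s₁ : K} (hz : v z ≠ 0) (hα : v α < 1) {m : ℕ} (hm : 1 ≤ m)
    (hs₀ : v s₀ = 1) (hs₁ : v s₁ = 1) : ¬ v (z * s₁) < v (z * α ^ m * s₀) :=
  lt_asymm (v_ray_fst_lt_mid v hz hα hm hs₀ hs₁)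

/-! ## §2 (O2) The Weyl flip `w(b·S_n)w⁻¹` is oriented -/

/-- **(O2a)** flipped frame `(d″0, u, d″1) := (e₂, e₁, e₀)`: `v(u) < v(d″0)` — the first side condition of the Levi frame
(★ `F0P3cStCharTSDeltaCosetConst`, hypothesis `v (finGammaTwo …) < v (d′ 0 …)`). [cite: Rogawski1990, §4.9 p. 56] -/
theorem v_mid_lt_flip_fst (σ : K → K) {z α s₁ s₂ : K} (hz : v z ≠ 0) (hσ : v (σ α) = v α) (hα0 : α ≠ 0)
    (hα : v α < 1) {m : ℕ} (hm : 1 ≤ m) (hs₁ : v s₁ = 1) (hs₂ : v s₂ = 1) :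
    v (z * s₁) < v (z * (σ α)⁻¹ ^ m * s₂) :=
  v_ray_mid_lt_last v σ hz hσ hα0 hα hm hs₁ hs₂

/-- **(O2b)** flipped frame: `v(d″1) < v(u)` — the second side condition (hypothesis `v (d′ 1 …) < v (finGammaTwo …)`).
[cite: Rogawski1990, §4.9 p. 56] -/
theorem v_flip_snd_lt_mid {z α s₀ s₁ : K} (hz : v z ≠ 0) (hα : v α < 1) {m : ℕ} (hm : 1 ≤ m)
    (hs₀ : v s₀ = 1) (hs₁ : v s₁ = 1) : v (z * α ^ m * s₀) < v (z * s₁) :=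
  v_ray_fst_lt_mid v hz hα hm hs₀ hs₁

/-- **(O2c)** flipped frame: `v(d″1) < v(d″0)` (★ `F0P3cStCharTSOnStratumLeviFrame`՚s orientation). [cite: Rogawski1990, §4.9 p. 56] -/
theorem v_flip_snd_lt_flip_fst (σ : K → K) {z α s₀ s₁ s₂ : K} (hz : v z ≠ 0) (hσ : v (σ α) = v α) (hα0 : α ≠ 0)
    (hα : v α < 1) {m : ℕ} (hm : 1 ≤ m) (hs₀ : v s₀ = 1) (hs₁ : v s₁ = 1) (hs₂ : v s₂ = 1) :
    v (z * α ^ m * s₀) < v (z * (σ α)⁻¹ ^ m * s₂) :=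
  v_ray_fst_lt_last v σ hz hσ hα0 hα hm hs₀ hs₁ hs₂

/-- **(O2) both side conditions at once** for the flipped frame, packaged as the conjunction the per-coset Levi step consumes.
[cite: Rogawski1990, §4.9 p. 56] -/
theorem flip_oriented (σ : K → K) {z α s₀ s₁ s₂ : K} (hz : v z ≠ 0) (hσ : v (σ α) = v α) (hα0 : α ≠ 0)
    (hα : v α < 1) {m : ℕ} (hm : 1 ≤ m) (hs₀ : v s₀ = 1) (hs₁ : v s₁ = 1) (hs₂ : v s₂ = 1) :
    v (z * s₁) < v (z * (σ α)⁻¹ ^ m * s₂) ∧ v (z * α ^ m * s₀) < v (z * s₁) :=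
  ⟨v_ray_mid_lt_last v σ hz hσ hα0 hα hm hs₁ hs₂, v_ray_fst_lt_mid v hz hα hm hs₀ hs₁⟩

/-- **(O2) unit spelling** of `flip_oriented`: with `v z = 1` (a central UNIT `z`) instead of `v z ≠ 0`. [cite: Rogawski1990, §4.9 p. 56] -/
theorem flip_oriented_of_v_eq_one (σ : K → K) {z α s₀ s₁ s₂ : K} (hz : v z = 1) (hσ : v (σ α) = v α) (hα0 : α ≠ 0)
    (hα : v α < 1) {m : ℕ} (hm : 1 ≤ m) (hs₀ : v s₀ = 1) (hs₁ : v s₁ = 1) (hs₂ : v s₂ = 1) :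
    v (z * s₁) < v (z * (σ α)⁻¹ ^ m * s₂) ∧ v (z * α ^ m * s₀) < v (z * s₁) :=
  flip_oriented v σ (hz ▸ one_ne_zero) hσ hα0 hα hm hs₀ hs₁ hs₂

/-- **(O2) TORUS**: the swapped pair keeps the torus relation — from `σ(d₀)·d₂ = 1` and `σ` involutive, `σ(d₂)·d₀ = 1`.
[cite: Rogawski1990, §4.9 p. 56] -/
theorem sigma_mul_eq_one_flip {R : Type*} [CommRing R] (σ : R →+* R) (hσσ : ∀ x, σ (σ x) = x) {a b : R}
    (h : σ a * b = 1) : σ b * a = 1 := by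
  have h' : σ (σ a * b) = 1 := by rw [h, map_one]
  rwa [map_mul, hσσ, mul_comm] at h'

/-- **(O2) TORUS, middle entry**: the middle relation `σ(u)·u = 1` is untouched by the flip (recorded for the packaged form).
[cite: Rogawski1990, §4.9 p. 56] -/
theorem flip_torus_rel {R : Type*} [CommRing R] (σ : R →+* R) (hσσ : ∀ x, σ (σ x) = x) {d₀ u d₂ : R}
    (h₀₂ : σ d₀ * d₂ = 1) (hu : σ u * u = 1) : σ d₂ * d₀ = 1 ∧ σ u * u = 1 :=
  ⟨sigma_mul_eq_one_flip σ hσσ h₀₂, hu⟩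

/-! ## §3 (O3) The two shells are disjoint at the level of diagonal entries -/

/-- **(O3)** a pair with `v x₀ < v x₁` is not a pair with `v y₁ < v y₀`: no diagonal frame is read both on `b·S_n`
(`v(d″0) < v(u)`) and on `B = w(b·S_n)w⁻¹` (`v(u) < v(d″0)`). [cite: Rogawski1990, L. 12.7.2 p. 193] -/
theorem ne_of_v_lt_of_v_gt {x₀ x₁ y₀ y₁ : K} (h : v x₀ < v x₁) (h' : v y₁ < v y₀) : (x₀, x₁) ≠ (y₀, y₁) := by
  rintro ⟨⟩
  exact lt_asymm h h'

/-- **(O3′)** functional form: if two frames agree entrywise then they cannot carry opposite orientations.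
[cite: Rogawski1990, L. 12.7.2 p. 193] -/
theorem v_lt_asymm_pair {x₀ x₁ y₀ y₁ : K} (h : v x₀ < v x₁) (h₀ : x₀ = y₀) (h₁ : x₁ = y₁) : ¬ v y₁ < v y₀ := by
  subst h₀ h₁
  exact lt_asymm h

/-- **(O3″)** the ray entries versus the flipped entries: `(e₀, e₁)` of a ray point is never `(e₂′, e₁′)` of a (possibly different)
ray point read through the flip. [cite: Rogawski1990, L. 12.7.2 p. 193] -/
theorem ray_pair_ne_flip_pair (σ : K → K) {z α s₀ s₁ z' α' s₁' s₂' : K} (hz : v z ≠ 0) (hα : v α < 1) {m : ℕ}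
    (hm : 1 ≤ m) (hs₀ : v s₀ = 1) (hs₁ : v s₁ = 1) (hz' : v z' ≠ 0) (hσ' : v (σ α') = v α') (hα0' : α' ≠ 0)
    (hα' : v α' < 1) {m' : ℕ} (hm' : 1 ≤ m') (hs₁' : v s₁' = 1) (hs₂' : v s₂' = 1) :
    (z * α ^ m * s₀, z * s₁) ≠ (z' * (σ α')⁻¹ ^ m' * s₂', z' * s₁') :=
  ne_of_v_lt_of_v_gt v (v_ray_fst_lt_mid v hz hα hm hs₀ hs₁) (v_ray_mid_lt_last v σ hz' hσ' hα0' hα' hm' hs₁' hs₂')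

end Summit.HodgeConjecture.HodgeConjecture.Cruxes.H413.F0P3cStCharTSShellOrientation
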